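import Summits.AtomisticToContinuum.HydrodynamicLimit.Theses.JParityClosure
import Summits.AtomisticToContinuum.HydrodynamicLimit.Theorems.JParityClosureRateFloorPairFunctionalRung0Integrability
import Summits.AtomisticToContinuum.HydrodynamicLimit.Theorems.LambertianContactSwapSwapGapGibbsDomination
import HarnessLib

/-!
# Crux `JParityClosure.RateFloor` (stmt-AtomisticToContinuum-13080), line `Sketch`: with the floor constant AFTER the mollification scale the crux is junk-true

Support file (`--supports stmt-AtomisticToContinuum-13080`; registered stub `stub_rateFloorGAfterR`, continuation lead c4) — a
QUANTIFIER-ORDER RECORD for the planner's restatement of the crux (companion of the disprover's `Negative/RAfterN`: `r` after `N` is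
junk-true; here: `g₀` after `r`).  For EVERY continuous positive local Gibbs datum, every `σ ≤ 1/2`, flow family, `τ`, continuous `χ`,
bounded continuous `Ξ ≥ 0`, `η, δ > 0` and EVERY `r > 0` there is `g₀ = g₀(…, r) > 0` such that for ALL `N`
`LG_N(K_N[χΞ] < g₀σ³∫₀^τ∫χB^Ξ_r − η) ≤ δ` — with NO input about the collision statistics: by conservation of the kinetic energy along
the flow the `r`-mollified pair functional is bounded pathwise, `∫₀^τ∫χB^Ξ_r ≤ τ‖χ‖(3/(πr³))²‖Ξ‖|S²|(½ + 4E(z)/(N+1))`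
(`RateFloorPairFunctionalUpper.pairFunctional_flow_le_of_mem_good`, c2), the collision functional is nonnegative, so the event forces
`E(z) > (A+1)(N+1)/δ`, which has probability `< δ` by Markov and the entropy-class moment bound `E_{LG_N}[E] ≤ A(N+1)`
(`exists_localGibbsLaw_dominated`).  Hence in any conforming restatement the floor constant must stay BEFORE `r` (it may move after the
confidence `δ`, see the line card: `RateFloorFlat`).  prover-line-stmt-AtomisticToContinuum-13080-c4-0.
-/

noncomputable section

open scoped BigOperators Topology ENNReal NNReal InnerProductSpace RealInnerProductSpace Classical
open MeasureTheory Set Filter Function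
open Literature.Analysis.FluidPDE Literature.MathematicalPhysics.KineticTheory
open Summit.AtomisticToContinuum.HydrodynamicLimit.Theses.JParityClosure

namespace Summit.AtomisticToContinuum.HydrodynamicLimit.Theorems.RateFloorGAfterR

/-- A continuous weight is bounded on the compact slab `[0, τ] × 𝕋³` (copy of `RateFloorRung0.exists_bound_on_slab`). [folklore] -/
theorem exists_bound_on_slab (χ : ℝ × UnitAddTorus (Fin 3) → ℝ) (hχ : Continuous χ) (τ : ℝ) :
    ∃ Mχ : ℝ, 0 ≤ Mχ ∧ ∀ u ∈ Set.Icc (0 : ℝ) τ, ∀ x : UnitAddTorus (Fin 3), |χ (u, x)| ≤ Mχ := by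
  have hK : IsCompact ((Set.Icc (0 : ℝ) τ) ×ˢ (Set.univ : Set (UnitAddTorus (Fin 3)))) :=
    isCompact_Icc.prod isCompact_univ
  obtain ⟨C, hC⟩ := hK.bddAbove_image hχ.norm.continuousOn
  refine ⟨max C 0, le_max_right _ _, fun u hu x => (le_max_left C 0).trans' ?_⟩
  have := hC ⟨(u, x), ⟨hu, Set.mem_univ _⟩, rfl⟩
  simpa [Real.norm_eq_abs] using this

/-- The crux's normalised collision functional of a NONNEGATIVE mark is nonnegative (a finite sum of nonnegative terms times
`ε/(N+1) ≥ 0`). [folklore] -/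
theorem kc_nonneg {N : ℕ} {c : ℝ} (hc : 0 ≤ c) (S : Set ℝ) (P : ℝ → Fin N → Fin N → Prop) [∀ s i j, Decidable (P s i j)]
    (F : ℝ → Fin N → Fin N → ℝ) (hF : ∀ s i j, 0 ≤ F s i j) :
    0 ≤ c * ∑ᶠ (s : ℝ) (_ : s ∈ S), ∑ i : Fin N, ∑ j : Fin N, (if P s i j then F s i j else 0) := by
  refine mul_nonneg hc (finsum_nonneg fun s => finsum_nonneg fun _ => ?_)
  exact Finset.sum_nonneg fun i _ => Finset.sum_nonneg fun j _ => by split_ifs <;> simp [hF]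

/-- Elementary: if `0 ≤ K`, `K < g I − η` with `0 < η`, `0 ≤ g` and `I ≤ a + b e` (`0 ≤ a, b`), `g a ≤ η/2`, then `η/2 < g b e`. [folklore] -/
theorem event_arith {K g I η a b e : ℝ} (hK : 0 ≤ K) (hz : K < g * I - η) (hg : 0 ≤ g)
    (hI : I ≤ a + b * e) (hga : g * a ≤ η / 2) : η / 2 < g * (b * e) := by
  have h1 : g * I ≤ g * (a + b * e) := mul_le_mul_of_nonneg_left hI hg
  nlinarith

/-- **`RateFloor` WITH THE FLOOR CONSTANT AFTER THE MOLLIFICATION SCALE IS JUNK-TRUE** (registered stub `stub_rateFloorGAfterR` of line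
`Sketch`).  For every continuous positive local Gibbs datum, `0 < σ ≤ 1/2`, flows, `τ > 0`, continuous `χ`, bounded continuous `Ξ ≥ 0`,
`η, δ > 0` and every `r > 0` there is `g₀ > 0` with `LG_N(K_N[χΞ] < g₀σ³∫₀^τ∫χB^Ξ_r − η) ≤ δ` for ALL `N`: energy conservation bounds the
pair functional pathwise by `C(r, χ, Ξ, τ)(½ + 4E(z)/(N+1))`, the collision functional is `≥ 0`, and `E_{LG_N}[E] ≤ A(N+1)` (Markov).
[folklore] -/
theorem stub_rateFloorGAfterR :
    ∀ (a₀ θ₀ : Literature.MathematicalPhysics.KineticTheory.T3 → ℝ) (u₀ : Literature.MathematicalPhysics.KineticTheory.T3 → Literature.MathematicalPhysics.KineticTheory.V3), Continuous a₀ → Continuous θ₀ → Continuous u₀ → (∀ x, 0 < a₀ x) → (∀ x, 0 < θ₀ x) → ∀ σ : ℝ, 0 < σ → σ ≤ 1 / 2 → ∀ Φ : (N : ℕ) → Literature.Analysis.FluidPDE.HardSphereFlow (Literature.Analysis.FluidPDE.Torus.geometry (Fin 3)) (Literature.MathematicalPhysics.KineticTheory.hsDiameter σ N) (N + 1), ∀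 τ : ℝ, 0 < τ → ∀ χ : ℝ × UnitAddTorus (Fin 3) → ℝ, Continuous χ → (∀ p, 0 ≤ χ p) → ∀ Ξ : EuclideanSpace ℝ (Fin 3) × EuclideanSpace ℝ (Fin 3) × EuclideanSpace ℝ (Fin 3) → ℝ, Continuous Ξ → (∀ q, 0 ≤ Ξ q) → (∃ C : ℝ, ∀ q, Ξ q ≤ C) → ∀ η δ : ℝ, 0 < η → 0 < δ → ∀ r : ℝ, 0 < r → ∃ g₀ : ℝ, 0 < g₀ ∧ ∀ N : ℕ, let ε := Literature.MathematicalPhysics.KineticTheory.hsDiameter σ N; let G := Literature.Analysis.FluidPDE.Torus.geometry (Fin 3); let γ := fun z (s : ℝ) => (Φ N).flow s z; let bx : UnitAddTorus (Fin 3) → UnitAddTorus (Fin 3) → ℝ := fun x y => 3 / (Real.pi * r ^ 3) * max (1 - Literature.Analysis.FluidPDE.Torus.euclidDist x y / r) 0; let Θ := fun (Ξ : EuclideanSpace ℝ (Fin 3) × EuclideanSpace ℝ (Fin 3) × EuclideanSpace ℝ (Fin 3) → ℝ) (v w : EuclideanSpace ℝ (Fin 3)) => ∫ ω : Metric.sphere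 (0 : EuclideanSpace ℝ (Fin 3)) 1, Ξ ((ω : EuclideanSpace ℝ (Fin 3)), v, w) * Literature.MathematicalPhysics.KineticTheory.hardSphereKernel (w, v) ω ∂Literature.MathematicalPhysics.KineticTheory.sphereMeasure; let B := fun Ξ z s (x₀ : UnitAddTorus (Fin 3)) => ∫ p, bx p.1.1 x₀ * bx p.2.1 x₀ * Θ Ξ p.1.2 p.2.2 ∂((Literature.Analysis.FluidPDE.empiricalMeasure (γ z s)).prod (Literature.Analysis.FluidPDE.empiricalMeasure (γ z s))); let pv := fun z s (i j : Fin (N + 1)) => Literature.Analysis.FluidPDE.reflectVel (G.sepVec (γ z s i).1 (γ z s j).1) ((γ z s i).2, (γ z s j).2); let Kc := fun (Fn : Literature.Analysis.FluidPDE.Config (N + 1) (Fin 3) Literature.MathematicalPhysics.KineticTheory.T3 → ℝ → Fin (N + 1) → Fin (N + 1) → ℝ) z => ε / (N + 1 : ℝ) * ∑ᶠ (s : ℝ) (_ : s ∈ Literature.Analysis.FluidPDE.collisionTimes G ε (γ z) ∩ Set.Icc 0 τ), ∑ i : Fin (N + 1), ∑ j : Fin (N + 1), (if i ≠ j ∧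 ‖G.sepVec (γ z s i).1 (γ z s j).1‖ = ε then Fn z s i j else 0); Literature.MathematicalPhysics.KineticTheory.localGibbsLaw σ a₀ u₀ θ₀ N (Φ N) {z | Kc (fun z s i j => χ (s, (γ z s i).1) * Ξ (ε⁻¹ • G.sepVec (γ z s i).1 (γ z s j).1, (pv z s i j).1, (pv z s i j).2)) z < g₀ * σ ^ 3 * (∫ s in Set.Icc (0 : ℝ) τ, ∫ x : UnitAddTorus (Fin 3), χ (s, x) * B Ξ z s x) - η} ≤ ENNReal.ofReal δ := by
  intro a₀ θ₀ u₀ ha hθ hu ha0 hθ0 σ hσ hσ2 Φ τ hτ χ hχc hχ0 Ξ hΞc hΞ0 hΞC η δ hη hδ r hr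
  haveI := isFiniteMeasure_sphereMeasure (E := V3)
  obtain ⟨C, hC⟩ := hΞC
  obtain ⟨Mχ, hMχ0, hMχ⟩ := exists_bound_on_slab χ hχc τ
  obtain ⟨A, bb, hA, hbb, hdom⟩ :=
    Summit.AtomisticToContinuum.HydrodynamicLimit.Theorems.LambertianContactSwapSwapGapGibbsDomination.exists_localGibbsLaw_dominated
      ha hθ hu ha0 hθ0 hσ2
  -- the pathwise constant of the pair functional
  set Kr : ℝ := (3 / (Real.pi * r ^ 3)) ^ 2 * (C * (sphereMeasure : Measure (Metric.sphere (0 : V3) 1)).real univ) with hKr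
  have hC0 : 0 ≤ C := (hΞ0 0).trans (hC 0)
  have hKr0 : 0 ≤ Kr := by rw [hKr]; exact mul_nonneg (by positivity) (mul_nonneg hC0 measureReal_nonneg)
  set a : ℝ := τ * (Mχ * (Kr * (1 / 2))) with ha_def
  set b : ℝ := τ * (Mχ * (Kr * 4)) with hb_def
  have ha0' : 0 ≤ a := by positivity
  have hb0' : 0 ≤ b := by positivity
  -- the floor constant (depends on r through Kr)
  set g₀ : ℝ := min (η / (2 * (σ ^ 3 * a + 1))) (η * δ / (2 * (A + 1) * (σ ^ 3 * b + 1))) with hg₀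
  have hg₀pos : 0 < g₀ := lt_min (by positivity) (by positivity)
  refine ⟨g₀, hg₀pos, fun N => ?_⟩
  intro ε G γ bx Θ B pv Kc
  set P := Literature.MathematicalPhysics.KineticTheory.localGibbsLaw σ a₀ u₀ θ₀ N (Φ N) with hP
  haveI : IsProbabilityMeasure P := isProbabilityMeasure_localGibbsLaw ha hθ hu ha0 hθ0 hσ2 N (Φ N)
  obtain ⟨-, -, -, hEint, hEle⟩ := hdom N (Φ N)
  have hn : (0 : ℝ) < (N : ℝ) + 1 := by positivity
  -- threshold for the kinetic energy
  set T : ℝ := (A + 1) * ((N : ℝ) + 1) / δ with hT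
  have hTpos : 0 < T := by positivity
  have hgood : P (Φ N).goodᶜ = 0 := by
    rw [hP, Literature.MathematicalPhysics.KineticTheory.localGibbsLaw, particleLaw_eq]
    exact withDensity_absolutelyContinuous _ _ (Φ N).measure_compl_good
  -- the event forces a large kinetic energy on good points
  have hsub : {z | Kc (fun z s i j => χ (s, (γ z s i).1) *
        Ξ (ε⁻¹ • G.sepVec (γ z s i).1 (γ z s j).1, (pv z s i j).1, (pv z s i j).2)) z <
        g₀ * σ ^ 3 * (∫ s in Set.Icc (0 : ℝ) τ, ∫ x : UnitAddTorus (Fin 3), χ (s, x) * B Ξ z s x) - η} ⊆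
      {z | T ≤ configEnergy z} ∪ (Φ N).goodᶜ := by
    intro z hz
    by_cases hzg : z ∈ (Φ N).good
    swap
    · exact Or.inr hzg
    left
    have hz' : Kc (fun z s i j => χ (s, (γ z s i).1) *
        Ξ (ε⁻¹ • G.sepVec (γ z s i).1 (γ z s j).1, (pv z s i j).1, (pv z s i j).2)) z <
        g₀ * σ ^ 3 * (∫ s in Set.Icc (0 : ℝ) τ, ∫ x : UnitAddTorus (Fin 3), χ (s, x) * B Ξ z s x) - η := hz
    -- (1) the collision functional is nonnegative
    have hK0 : 0 ≤ Kc (fun z s i j => χ (s, (γ z s i).1) *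
        Ξ (ε⁻¹ • G.sepVec (γ z s i).1 (γ z s j).1, (pv z s i j).1, (pv z s i j).2)) z := by
      refine kc_nonneg (div_nonneg (hsDiameter_pos hσ N).le hn.le) _ _ _ fun s i j => ?_
      exact mul_nonneg (hχ0 _) (hΞ0 _)
    -- (2) pathwise bound on the pair functional by the conserved kinetic energy
    have hBpt : ∀ (s : ℝ) (x : UnitAddTorus (Fin 3)), B Ξ z s x ≤ Kr * (1 / 2 + 4 * ((((N + 1 : ℕ) : ℝ))⁻¹ * configEnergy z)) :=
      fun s x => RateFloorPairFunctionalUpper.pairFunctional_flow_le_of_mem_good hr hΞc hΞ0 hC (Φ N) hzg s x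
    have hB0 : ∀ (s : ℝ) (x : UnitAddTorus (Fin 3)), 0 ≤ B Ξ z s x := fun s x =>
      RateFloorPairFunctionalUpper.pairFunctional_nonneg hr hΞ0 _ _
    have hE0 : 0 ≤ configEnergy z := by
      unfold configEnergy; exact mul_nonneg (by norm_num) (Finset.sum_nonneg fun i _ => sq_nonneg _)
    set e : ℝ := (((N + 1 : ℕ) : ℝ))⁻¹ * configEnergy z with he
    have he0 : 0 ≤ e := by positivity
    have hx : ∀ s ∈ Set.Icc (0 : ℝ) τ, ‖∫ x : UnitAddTorus (Fin 3), χ (s, x) * B Ξ z s x‖ ≤ Mχ * (Kr * (1 / 2 + 4 * e)) := by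
      intro s hs
      have h1 : ∀ x : UnitAddTorus (Fin 3), ‖χ (s, x) * B Ξ z s x‖ ≤ Mχ * (Kr * (1 / 2 + 4 * e)) := fun x => by
        rw [norm_mul, Real.norm_eq_abs, Real.norm_eq_abs, abs_of_nonneg (hB0 s x)]
        exact mul_le_mul (hMχ s hs x) (hBpt s x) (hB0 s x) hMχ0
      have h2 := norm_integral_le_of_norm_le_const (μ := (volume : Measure (UnitAddTorus (Fin 3)))) (Eventually.of_forall h1)
      simpa using h2
    have hI : ∫ s in Set.Icc (0 : ℝ) τ, ∫ x : UnitAddTorus (Fin 3), χ (s, x) * B Ξ z s x ≤ a + b * e := by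
      have h1 : ∀ᵐ s ∂(volume.restrict (Set.Icc (0 : ℝ) τ)), ‖∫ x : UnitAddTorus (Fin 3), χ (s, x) * B Ξ z s x‖ ≤
          Mχ * (Kr * (1 / 2 + 4 * e)) := (ae_restrict_iff' measurableSet_Icc).2 (Eventually.of_forall hx)
      have h2 := norm_integral_le_of_norm_le_const h1
      rw [measureReal_restrict_apply_univ, Real.volume_real_Icc_of_le hτ.le, sub_zero] at h2
      have h3 := (le_abs_self _).trans (Real.norm_eq_abs _ ▸ h2)
      have h4 : Mχ * (Kr * (1 / 2 + 4 * e)) * τ = a + b * e := by rw [ha_def, hb_def]; ring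
      linarith
    -- (3) arithmetic: η/2 < g₀ σ³ b e, hence e > (A+1)/δ
    have hgσ : 0 ≤ g₀ * σ ^ 3 := by positivity
    have hga : g₀ * σ ^ 3 * a ≤ η / 2 := by
      have h1 : g₀ ≤ η / (2 * (σ ^ 3 * a + 1)) := min_le_left _ _
      have h2 : g₀ * (σ ^ 3 * a + 1) ≤ η / 2 := by
        rw [le_div_iff₀ (by positivity)] at h1; nlinarith
      nlinarith [mul_nonneg hg₀pos.le ha0']
    have hz2 : Kc (fun z s i j => χ (s, (γ z s i).1) *
        Ξ (ε⁻¹ • G.sepVec (γ z s i).1 (γ z s j).1, (pv z s i j).1, (pv z s i j).2)) z <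
        (g₀ * σ ^ 3) * (∫ s in Set.Icc (0 : ℝ) τ, ∫ x : UnitAddTorus (Fin 3), χ (s, x) * B Ξ z s x) - η := by
      simpa [mul_assoc] using hz'
    have hkey := event_arith hK0 hz2 hgσ hI (by simpa [mul_assoc] using hga)
    -- hkey : η / 2 < g₀ σ³ (b e)
    have hgb : g₀ * σ ^ 3 * b ≤ η * δ / (2 * (A + 1)) := by
      have h1 : g₀ ≤ η * δ / (2 * (A + 1) * (σ ^ 3 * b + 1)) := min_le_right _ _
      rw [le_div_iff₀ (by positivity)] at h1
      rw [le_div_iff₀ (by positivity)]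
      nlinarith [mul_nonneg hg₀pos.le hb0']
    have he_big : (A + 1) / δ < e := by
      by_contra hcon
      push Not at hcon
      have h1 : g₀ * σ ^ 3 * (b * e) ≤ η * δ / (2 * (A + 1)) * ((A + 1) / δ) := by
        calc g₀ * σ ^ 3 * (b * e) = (g₀ * σ ^ 3 * b) * e := by ring
          _ ≤ η * δ / (2 * (A + 1)) * e := mul_le_mul_of_nonneg_right hgb he0
          _ ≤ η * δ / (2 * (A + 1)) * ((A + 1) / δ) := mul_le_mul_of_nonneg_left hcon (by positivity)
      have h2 : η * δ / (2 * (A + 1)) * ((A + 1) / δ) = η / 2 := by field_simp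
      linarith
    -- translate to the energy threshold
    show T ≤ configEnergy z
    rw [hT, div_le_iff₀ hδ]
    rw [he, div_lt_iff₀ hδ] at he_big
    have h1 : (A + 1) < (((N + 1 : ℕ) : ℝ))⁻¹ * configEnergy z * δ := he_big
    have h2 : (((N + 1 : ℕ) : ℝ)) = (N : ℝ) + 1 := by push_cast; ring
    rw [h2] at h1
    have h3 : ((N : ℝ) + 1)⁻¹ * configEnergy z * δ * ((N : ℝ) + 1) = configEnergy z * δ := by field_simp
    have h4 : (A + 1) * ((N : ℝ) + 1) < configEnergy z * δ := by
      have := mul_lt_mul_of_pos_right h1 hn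
      rwa [h3] at this
    exact h4.le
  -- Markov
  have hmarkov : P {z | T ≤ configEnergy z} ≤ ENNReal.ofReal δ := by
    have h1 := mul_meas_ge_le_integral_of_nonneg (μ := P) (Eventually.of_forall fun z => ?_) hEint T
    swap
    · unfold configEnergy; exact mul_nonneg (by norm_num) (Finset.sum_nonneg fun i _ => sq_nonneg _)
    have h2 : T * P.real {z | T ≤ configEnergy z} ≤ A * ((N : ℝ) + 1) := h1.trans hEle
    have h3 : P.real {z | T ≤ configEnergy z} ≤ δ := by
      by_contra hcon
      push Not at hcon
      have : T * δ < T * P.real {z | T ≤ configEnergy z} := mul_lt_mul_of_pos_left hcon hTpos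
      have h4 : T * δ = (A + 1) * ((N : ℝ) + 1) := by rw [hT]; field_simp
      nlinarith
    calc P {z | T ≤ configEnergy z} = ENNReal.ofReal (P.real {z | T ≤ configEnergy z}) :=
          (ENNReal.ofReal_toReal (measure_ne_top _ _)).symm
      _ ≤ ENNReal.ofReal δ := ENNReal.ofReal_le_ofReal h3
  calc P _ ≤ P ({z | T ≤ configEnergy z} ∪ (Φ N).goodᶜ) := measure_mono hsub
    _ ≤ P {z | T ≤ configEnergy z} + P (Φ N).goodᶜ := measure_union_le _ _
    _ ≤ ENNReal.ofReal δ + 0 := add_le_add hmarkov hgood.le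
    _ = ENNReal.ofReal δ := add_zero _

end Summit.AtomisticToContinuum.HydrodynamicLimit.Theorems.RateFloorGAfterR

end
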